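import Literature.NumberTheory.Transcendental.CubeChartBasics
import HarnessLib

/-!
# Monomial germs with analytic units along a set

Elementary calculus of functions `f : ℝⁿ → ℝ` which, on a neighbourhood of a set `K ⊆ ℝⁿ`
(typically the closed unit cube), have the form `f = xᵖ · u` with `xᵖ = ∏ᵢ xᵢ^{pᵢ}` a monomial and
`u` a real-analytic unit, positive (`0 < u`) or merely nowhere zero (`u ≠ 0`). "On a neighbourhood
of `K`" is phrased with the set-neighbourhood filter `𝓝ˢ K`, so that finitely many germs intersect
for free. The closure properties recorded here are the bookkeeping half of the last step of an
embedded resolution / rectilinearisation argument (Bierstone–Milman 1988, §4; Parusiński 1994):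

* products, powers and finite products of positive (resp. nowhere-zero) monomial germs are again
  such germs (exponents add);
* on a set `K` inside the closed positive orthant, the SUM of two positive monomial germs with
  COMPARABLE exponents `p ≤ q` is a positive monomial germ with exponent `p`
  (`xᵖu + x^q w = xᵖ (u + x^{q-p} w)`, the bracket being positive near `K`), and likewise
  `(xᵖu)² + xʳw` when `2p` and `r` are comparable;
* unpacking to the "cube-monomial on an open `U ⊇ K`" format used by the Kontsevich–Zagier
  normal-form files (`(∏ xᵢ^{aᵢ} (1 - xᵢ)^{bᵢ}) · e`, `e` analytic and nowhere zero on `U`, with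
  `b = 0`).

No definitions are introduced (the two germ predicates are spelled out in every statement).

## References

* E. Bierstone, P. Milman, *Semianalytic and subanalytic sets*, Publ. IHÉS 67 (1988), §4.
* M. Kontsevich, D. Zagier, *Periods* (2001), §1.2.
-/

noncomputable section

open Filter Topology Set

namespace Literature.NumberTheory.Transcendental

variable {n : ℕ} {K : Set (Fin n → ℝ)}

/-! ### Products and powers of monomial germs -/

/-- A positive analytic unit near `K` is a positive monomial germ with exponent `0`. [folklore] -/
theorem exists_posMonomialGerm_of_unit {u : (Fin n → ℝ) → ℝ}
    (h : ∀ᶠ x in 𝓝ˢ K, AnalyticAt ℝ u x ∧ 0 < u x) :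
    ∃ u' : (Fin n → ℝ) → ℝ, ∀ᶠ x in 𝓝ˢ K,
      AnalyticAt ℝ u' x ∧ 0 < u' x ∧ u x = (∏ i, x i ^ (0 : Fin n → ℕ) i) * u' x :=
  ⟨u, h.mono fun x hx => ⟨hx.1, hx.2, by simp⟩⟩

/-- The product of two positive monomial germs is a positive monomial germ; exponents add.
[folklore] -/
theorem exists_posMonomialGerm_mul {f g : (Fin n → ℝ) → ℝ} {p q : Fin n → ℕ}
    (hf : ∃ u : (Fin n → ℝ) → ℝ, ∀ᶠ x in 𝓝ˢ K,
      AnalyticAt ℝ u x ∧ 0 < u x ∧ f x = (∏ i, x i ^ p i) * u x)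
    (hg : ∃ u : (Fin n → ℝ) → ℝ, ∀ᶠ x in 𝓝ˢ K,
      AnalyticAt ℝ u x ∧ 0 < u x ∧ g x = (∏ i, x i ^ q i) * u x) :
    ∃ u : (Fin n → ℝ) → ℝ, ∀ᶠ x in 𝓝ˢ K,
      AnalyticAt ℝ u x ∧ 0 < u x ∧ f x * g x = (∏ i, x i ^ (p + q) i) * u x := by
  obtain ⟨u, hu⟩ := hf
  obtain ⟨w, hw⟩ := hg
  refine ⟨fun x => u x * w x, (hu.and hw).mono fun x hx => ?_⟩
  obtain ⟨⟨hua, hup, hfx⟩, ⟨hwa, hwp, hgx⟩⟩ := hx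
  refine ⟨hua.mul hwa, mul_pos hup hwp, ?_⟩
  rw [hfx, hgx, ← prod_pow_mul_prod_pow]
  ring

/-- The product of two nowhere-zero monomial germs is a nowhere-zero monomial germ. [folklore] -/
theorem exists_monomialGerm_mul {f g : (Fin n → ℝ) → ℝ} {p q : Fin n → ℕ}
    (hf : ∃ u : (Fin n → ℝ) → ℝ, ∀ᶠ x in 𝓝ˢ K,
      AnalyticAt ℝ u x ∧ u x ≠ 0 ∧ f x = (∏ i, x i ^ p i) * u x)
    (hg : ∃ u : (Fin n → ℝ) → ℝ, ∀ᶠ x in 𝓝ˢ K,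
      AnalyticAt ℝ u x ∧ u x ≠ 0 ∧ g x = (∏ i, x i ^ q i) * u x) :
    ∃ u : (Fin n → ℝ) → ℝ, ∀ᶠ x in 𝓝ˢ K,
      AnalyticAt ℝ u x ∧ u x ≠ 0 ∧ f x * g x = (∏ i, x i ^ (p + q) i) * u x := by
  obtain ⟨u, hu⟩ := hf
  obtain ⟨w, hw⟩ := hg
  refine ⟨fun x => u x * w x, (hu.and hw).mono fun x hx => ?_⟩
  obtain ⟨⟨hua, hup, hfx⟩, ⟨hwa, hwp, hgx⟩⟩ := hx
  refine ⟨hua.mul hwa, mul_ne_zero hup hwp, ?_⟩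
  rw [hfx, hgx, ← prod_pow_mul_prod_pow]
  ring

/-- A positive monomial germ is a nowhere-zero monomial germ. [folklore] -/
theorem exists_monomialGerm_of_pos {f : (Fin n → ℝ) → ℝ} {p : Fin n → ℕ}
    (hf : ∃ u : (Fin n → ℝ) → ℝ, ∀ᶠ x in 𝓝ˢ K,
      AnalyticAt ℝ u x ∧ 0 < u x ∧ f x = (∏ i, x i ^ p i) * u x) :
    ∃ u : (Fin n → ℝ) → ℝ, ∀ᶠ x in 𝓝ˢ K,
      AnalyticAt ℝ u x ∧ u x ≠ 0 ∧ f x = (∏ i, x i ^ p i) * u x := by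
  obtain ⟨u, hu⟩ := hf
  exact ⟨u, hu.mono fun x hx => ⟨hx.1, hx.2.1.ne', hx.2.2⟩⟩

/-- A positive monomial germ times a positive analytic unit is a positive monomial germ with the
same exponent. [folklore] -/
theorem exists_posMonomialGerm_mul_unit {f e : (Fin n → ℝ) → ℝ} {p : Fin n → ℕ}
    (hf : ∃ u : (Fin n → ℝ) → ℝ, ∀ᶠ x in 𝓝ˢ K,
      AnalyticAt ℝ u x ∧ 0 < u x ∧ f x = (∏ i, x i ^ p i) * u x)
    (he : ∀ᶠ x in 𝓝ˢ K, AnalyticAt ℝ e x ∧ 0 < e x) :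
    ∃ u : (Fin n → ℝ) → ℝ, ∀ᶠ x in 𝓝ˢ K,
      AnalyticAt ℝ u x ∧ 0 < u x ∧ f x * e x = (∏ i, x i ^ p i) * u x := by
  obtain ⟨u, hu⟩ := hf
  refine ⟨fun x => u x * e x, (hu.and he).mono fun x hx => ?_⟩
  obtain ⟨⟨hua, hup, hfx⟩, ⟨hea, hep⟩⟩ := hx
  exact ⟨hua.mul hea, mul_pos hup hep, by rw [hfx]; ring⟩

/-- A positive monomial germ times a nowhere-zero analytic unit is a nowhere-zero monomial germ with
the same exponent. [folklore] -/
theorem exists_monomialGerm_mul_unit {f e : (Fin n → ℝ) → ℝ} {p : Fin n → ℕ}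
    (hf : ∃ u : (Fin n → ℝ) → ℝ, ∀ᶠ x in 𝓝ˢ K,
      AnalyticAt ℝ u x ∧ 0 < u x ∧ f x = (∏ i, x i ^ p i) * u x)
    (he : ∀ᶠ x in 𝓝ˢ K, AnalyticAt ℝ e x ∧ e x ≠ 0) :
    ∃ u : (Fin n → ℝ) → ℝ, ∀ᶠ x in 𝓝ˢ K,
      AnalyticAt ℝ u x ∧ u x ≠ 0 ∧ f x * e x = (∏ i, x i ^ p i) * u x := by
  obtain ⟨u, hu⟩ := hf
  refine ⟨fun x => u x * e x, (hu.and he).mono fun x hx => ?_⟩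
  obtain ⟨⟨hua, hup, hfx⟩, ⟨hea, hep⟩⟩ := hx
  exact ⟨hua.mul hea, mul_ne_zero hup.ne' hep, by rw [hfx]; ring⟩

/-- Powers of a positive monomial germ. [folklore] -/
theorem exists_posMonomialGerm_pow {f : (Fin n → ℝ) → ℝ} {p : Fin n → ℕ}
    (hf : ∃ u : (Fin n → ℝ) → ℝ, ∀ᶠ x in 𝓝ˢ K,
      AnalyticAt ℝ u x ∧ 0 < u x ∧ f x = (∏ i, x i ^ p i) * u x) (m : ℕ) :
    ∃ u : (Fin n → ℝ) → ℝ, ∀ᶠ x in 𝓝ˢ K,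
      AnalyticAt ℝ u x ∧ 0 < u x ∧ f x ^ m = (∏ i, x i ^ (m • p) i) * u x := by
  obtain ⟨u, hu⟩ := hf
  refine ⟨fun x => u x ^ m, hu.mono fun x hx => ?_⟩
  obtain ⟨hua, hup, hfx⟩ := hx
  refine ⟨hua.pow m, pow_pos hup m, ?_⟩
  rw [hfx, mul_pow, prod_pow_pow]

/-- Finite products of positive monomial germs are positive monomial germs. [folklore] -/
theorem exists_posMonomialGerm_prod {ι : Type*} (s : Finset ι) (f : ι → (Fin n → ℝ) → ℝ)
    (hf : ∀ l ∈ s, ∃ (p : Fin n → ℕ) (u : (Fin n → ℝ) → ℝ), ∀ᶠ x in 𝓝ˢ K,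
      AnalyticAt ℝ u x ∧ 0 < u x ∧ f l x = (∏ i, x i ^ p i) * u x) :
    ∃ (p : Fin n → ℕ) (u : (Fin n → ℝ) → ℝ), ∀ᶠ x in 𝓝ˢ K,
      AnalyticAt ℝ u x ∧ 0 < u x ∧ (∏ l ∈ s, f l x) = (∏ i, x i ^ p i) * u x := by
  classical
  induction s using Finset.induction_on with
  | empty => exact ⟨0, fun _ => 1, Eventually.of_forall fun x => ⟨analyticAt_const, one_pos, by simp⟩⟩
  | insert a s ha ih =>
    obtain ⟨p, hp⟩ := hf a (Finset.mem_insert_self a s)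
    obtain ⟨q, hq⟩ := ih fun l hl => hf l (Finset.mem_insert_of_mem hl)
    refine ⟨p + q, ?_⟩
    obtain ⟨u, hu⟩ := exists_posMonomialGerm_mul hp hq
    exact ⟨u, hu.mono fun x hx => ⟨hx.1, hx.2.1, by rw [Finset.prod_insert ha]; exact hx.2.2⟩⟩

/-- Finite products of nowhere-zero monomial germs are nowhere-zero monomial germs. [folklore] -/
theorem exists_monomialGerm_prod {ι : Type*} (s : Finset ι) (f : ι → (Fin n → ℝ) → ℝ)
    (hf : ∀ l ∈ s, ∃ (p : Fin n → ℕ) (u : (Fin n → ℝ) → ℝ), ∀ᶠ x in 𝓝ˢ K,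
      AnalyticAt ℝ u x ∧ u x ≠ 0 ∧ f l x = (∏ i, x i ^ p i) * u x) :
    ∃ (p : Fin n → ℕ) (u : (Fin n → ℝ) → ℝ), ∀ᶠ x in 𝓝ˢ K,
      AnalyticAt ℝ u x ∧ u x ≠ 0 ∧ (∏ l ∈ s, f l x) = (∏ i, x i ^ p i) * u x := by
  classical
  induction s using Finset.induction_on with
  | empty =>
    exact ⟨0, fun _ => 1, Eventually.of_forall fun x => ⟨analyticAt_const, one_ne_zero, by simp⟩⟩
  | insert a s ha ih =>
    obtain ⟨p, hp⟩ := hf a (Finset.mem_insert_self a s)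
    obtain ⟨q, hq⟩ := ih fun l hl => hf l (Finset.mem_insert_of_mem hl)
    refine ⟨p + q, ?_⟩
    obtain ⟨u, hu⟩ := exists_monomialGerm_mul hp hq
    exact ⟨u, hu.mono fun x hx => ⟨hx.1, hx.2.1, by rw [Finset.prod_insert ha]; exact hx.2.2⟩⟩

/-- Monomial germs only depend on the germ of the function along `K`. [folklore] -/
theorem exists_monomialGerm_congr {f g : (Fin n → ℝ) → ℝ} {p : Fin n → ℕ} {P : ℝ → Prop}
    (hfg : ∀ᶠ x in 𝓝ˢ K, f x = g x)
    (hf : ∃ u : (Fin n → ℝ) → ℝ, ∀ᶠ x in 𝓝ˢ K,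
      AnalyticAt ℝ u x ∧ P (u x) ∧ f x = (∏ i, x i ^ p i) * u x) :
    ∃ u : (Fin n → ℝ) → ℝ, ∀ᶠ x in 𝓝ˢ K,
      AnalyticAt ℝ u x ∧ P (u x) ∧ g x = (∏ i, x i ^ p i) * u x := by
  obtain ⟨u, hu⟩ := hf
  exact ⟨u, (hu.and hfg).mono fun x hx => ⟨hx.1.1, hx.1.2.1, hx.2 ▸ hx.1.2.2⟩⟩

/-! ### Sums of comparable positive monomial germs -/

/-- **Comparable sums.** On a set `K` in the closed positive orthant, the sum of two positive
monomial germs with exponents `p ≤ q` is a positive monomial germ with exponent `p`: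
`xᵖu + x^q w = xᵖ (u + x^{q-p} w)` and the bracket is positive on `K`, hence near `K`.
[folklore] -/
theorem exists_posMonomialGerm_add_of_le (hK : ∀ x ∈ K, ∀ i, 0 ≤ x i)
    {f g : (Fin n → ℝ) → ℝ} {p q : Fin n → ℕ} (hpq : p ≤ q)
    (hf : ∃ u : (Fin n → ℝ) → ℝ, ∀ᶠ x in 𝓝ˢ K,
      AnalyticAt ℝ u x ∧ 0 < u x ∧ f x = (∏ i, x i ^ p i) * u x)
    (hg : ∃ u : (Fin n → ℝ) → ℝ, ∀ᶠ x in 𝓝ˢ K,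
      AnalyticAt ℝ u x ∧ 0 < u x ∧ g x = (∏ i, x i ^ q i) * u x) :
    ∃ u : (Fin n → ℝ) → ℝ, ∀ᶠ x in 𝓝ˢ K,
      AnalyticAt ℝ u x ∧ 0 < u x ∧ f x + g x = (∏ i, x i ^ p i) * u x := by
  obtain ⟨u, hu⟩ := hf
  obtain ⟨w, hw⟩ := hg
  set b : (Fin n → ℝ) → ℝ := fun x => u x + (∏ i, x i ^ (q i - p i)) * w x with hb
  have hba : ∀ x, AnalyticAt ℝ u x → AnalyticAt ℝ w x → AnalyticAt ℝ b x := fun x hux hwx =>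
    hux.add ((analyticAt_prod_pow (fun i => q i - p i) x).mul hwx)
  -- positivity of the bracket near `K`
  have hpos : ∀ᶠ x in 𝓝ˢ K, 0 < b x := by
    rw [eventually_nhdsSet_iff_forall]
    intro x hx
    obtain ⟨hux, hup, -⟩ := hu.self_of_nhdsSet x hx
    obtain ⟨hwx, hwp, -⟩ := hw.self_of_nhdsSet x hx
    have hbx : 0 < b x :=
      add_pos_of_pos_of_nonneg hup (mul_nonneg (prod_pow_nonneg (hK x hx) _) hwp.le)
    exact Filter.Tendsto.eventually_const_lt hbx (hba x hux hwx).continuousAt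
  refine ⟨b, ((hu.and hw).and hpos).mono fun x hx => ?_⟩
  obtain ⟨⟨⟨hux, -, hfx⟩, ⟨hwx, -, hgx⟩⟩, hbx⟩ := hx
  refine ⟨hba x hux hwx, hbx, ?_⟩
  rw [hfx, hgx, prod_pow_eq_mul_of_le x hpq, hb]
  ring

/-- Comparable sums, symmetric form: if `p ≤ q` or `q ≤ p` the sum is a positive monomial germ
with exponent `p` or `q`. [folklore] -/
theorem exists_posMonomialGerm_add (hK : ∀ x ∈ K, ∀ i, 0 ≤ x i)
    {f g : (Fin n → ℝ) → ℝ} {p q : Fin n → ℕ} (hpq : p ≤ q ∨ q ≤ p)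
    (hf : ∃ u : (Fin n → ℝ) → ℝ, ∀ᶠ x in 𝓝ˢ K,
      AnalyticAt ℝ u x ∧ 0 < u x ∧ f x = (∏ i, x i ^ p i) * u x)
    (hg : ∃ u : (Fin n → ℝ) → ℝ, ∀ᶠ x in 𝓝ˢ K,
      AnalyticAt ℝ u x ∧ 0 < u x ∧ g x = (∏ i, x i ^ q i) * u x) :
    ∃ r : Fin n → ℕ, (r = p ∨ r = q) ∧ ∃ u : (Fin n → ℝ) → ℝ, ∀ᶠ x in 𝓝ˢ K,
      AnalyticAt ℝ u x ∧ 0 < u x ∧ f x + g x = (∏ i, x i ^ r i) * u x := by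
  rcases hpq with h | h
  · exact ⟨p, Or.inl rfl, exists_posMonomialGerm_add_of_le hK h hf hg⟩
  · refine ⟨q, Or.inr rfl, ?_⟩
    obtain ⟨u, hu⟩ := exists_posMonomialGerm_add_of_le hK h hg hf
    exact ⟨u, hu.mono fun x hx => ⟨hx.1, hx.2.1, by rw [add_comm]; exact hx.2.2⟩⟩

/-- **Squares plus comparable terms.** `(xᵖu)² + xʳw` is a positive monomial germ when `2p` and
`r` are comparable. [folklore] -/
theorem exists_posMonomialGerm_sq_add (hK : ∀ x ∈ K, ∀ i, 0 ≤ x i)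
    {f g : (Fin n → ℝ) → ℝ} {p r : Fin n → ℕ} (hpr : 2 • p ≤ r ∨ r ≤ 2 • p)
    (hf : ∃ u : (Fin n → ℝ) → ℝ, ∀ᶠ x in 𝓝ˢ K,
      AnalyticAt ℝ u x ∧ 0 < u x ∧ f x = (∏ i, x i ^ p i) * u x)
    (hg : ∃ u : (Fin n → ℝ) → ℝ, ∀ᶠ x in 𝓝ˢ K,
      AnalyticAt ℝ u x ∧ 0 < u x ∧ g x = (∏ i, x i ^ r i) * u x) :
    ∃ (s : Fin n → ℕ) (u : (Fin n → ℝ) → ℝ), ∀ᶠ x in 𝓝ˢ K,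
      AnalyticAt ℝ u x ∧ 0 < u x ∧ f x ^ 2 + g x = (∏ i, x i ^ s i) * u x := by
  obtain ⟨s, -, hs⟩ := exists_posMonomialGerm_add hK hpr (exists_posMonomialGerm_pow hf 2) hg
  exact ⟨s, hs⟩

/-! ### Unpacking to the cube-monomial format -/

/-- A nowhere-zero monomial germ along `K`, unpacked: on some open `U ⊇ K` the function is a
cube-monomial `(∏ xᵢ^{aᵢ} (1 - xᵢ)^{bᵢ}) · e` (with `b = 0`) times an analytic nowhere-zero `e`.
[folklore] -/
theorem exists_open_cubeMonomial_of_monomialGerm {f : (Fin n → ℝ) → ℝ} {p : Fin n → ℕ}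
    (hf : ∃ u : (Fin n → ℝ) → ℝ, ∀ᶠ x in 𝓝ˢ K,
      AnalyticAt ℝ u x ∧ u x ≠ 0 ∧ f x = (∏ i, x i ^ p i) * u x) :
    ∃ U : Set (Fin n → ℝ), IsOpen U ∧ K ⊆ U ∧ ∃ (a b : Fin n → ℕ) (e : (Fin n → ℝ) → ℝ),
      AnalyticOnNhd ℝ e U ∧ (∀ x ∈ U, e x ≠ 0) ∧
        ∀ x ∈ U, f x = (∏ i, x i ^ a i * (1 - x i) ^ b i) * e x := by
  obtain ⟨u, hu⟩ := hf
  obtain ⟨U, hUo, hKU, hU⟩ := eventually_nhdsSet_iff_exists.1 hu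
  refine ⟨U, hUo, hKU, p, 0, u, fun x hx => (hU x hx).1, fun x hx => (hU x hx).2.1, fun x hx => ?_⟩
  rw [(hU x hx).2.2]
  simp

end Literature.NumberTheory.Transcendental
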